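import Literature.Topology.FourManifolds.LadderSurfaceStraightening
import Literature.Topology.FourManifolds.CollarTheorem
import Literature.Topology.FourManifolds.AmbientIsotopyTransport
import HarnessLib

/-!
# Extending a boundary diffeomorphism of the ladder body, diffeotopic to the identity, over
# the body

Topic `Literature/Topology/FourManifolds`; brick E4b of the constructive road (P1′) to
`Literature.Topology.FourManifolds.Trisection.isConnectedSum_of_reducing_separating`
(`ReducibleTrisectionSplitting.lean`, § Status), sequel of `LadderSurfaceStraightening.lean`
(whose straightening diffeomorphism `Φ` of `∂Z` is diffeotopic to the identity).

* `Body` — the ladder body `Z = {G ≤ c}` as a compact `4`-manifold with boundary (the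
  four-thickening of the ladder), `bodyBoundaryData` its boundary datum, `toBody` the inclusion
  of the level `{G = c}`;
* `boundaryDiffeomorphBdry : ∂Z ≃ₘ Bdry` — the boundary subtype of the body IS the boundary
  level manifold (identity on points; smooth both ways by `ContMDiff.iff_comp_isImmersion`);
* `exists_diffeomorph_body_extends` — **a diffeomorphism `Φ` of `Bdry` diffeotopic to the
  identity extends to a diffeomorphism `Ψ` of `Z`** with `Ψ (toBody q) = Φ q` on points
  (conjugate an ambient isotopy to the boundary subtype, `AmbientIsotopy.transfer`,
  `AmbientIsotopy.isDiffeotopicToId`; then the collar fact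
  `BoundaryData.diffeoExtends_of_isDiffeotopicToId_holds`, Hirsch Ch. 8 §2, Thm. 2.3).

Everything is **proved**; no named fact is introduced.

## References
* M. W. Hirsch, *Differential Topology* (1976), Ch. 8 §2, proof of Thm. 2.3. [HirschDT1976]
-/

noncomputable section

open scoped Topology ContDiff Manifold
open Set Filter Real

namespace Literature.Topology.FourManifolds

/-- Local notation: `𝔼 n` is the model Euclidean space `EuclideanSpace ℝ (Fin n)`. -/
local notation "𝔼 " n:arg => EuclideanSpace ℝ (Fin n)

namespace Ladder.Params

variable {k : ℕ} (P : Params k)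

/-! ### §1 The ladder body as a compact `4`-manifold with boundary, and its boundary datum -/

/-- **The ladder body** `Z = {G ≤ c}`, a compact `4`-manifold with boundary (the
four-thickening of the ladder). [folklore] -/
abbrev Body : Type := P.isHoledDiscMorseFunction.FourThickening

/-- The boundary datum of the ladder body (the boundary subtype `∂Z`). [folklore] -/
abbrev bodyBoundaryData : BoundaryData (𝓡∂ 4) P.Body (𝓡 3) :=
  RegularSublevel.boundaryData P.isRegularLevel_bodyG

/-- A boundary point of the body lies on the level `{G = c}`. [folklore] -/
theorem apply_eq_of_boundary (z : (𝓡∂ 4).boundary P.Body) : P.bodyG z.1.1 = P.level :=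
  (RegularSublevel.mem_boundary_iff P.isRegularLevel_bodyG z.1).1 z.2

/-- A point of the level `{G = c}` as a point of the body. [folklore] -/
def toBody (q : P.Bdry) : P.Body := ⟨q.1, le_of_eq q.2⟩

/-- `toBody` is the identity on points of `ℝ⁴` (definitional). [folklore] -/
@[simp] theorem toBody_val (q : P.Bdry) : (P.toBody q).1 = q.1 := rfl

/-- A point of the level `{G = c}` is a boundary point of the body. [folklore] -/
theorem mem_boundary_of_level (q : P.Bdry) : P.toBody q ∈ (𝓡∂ 4).boundary P.Body :=
  (RegularSublevel.mem_boundary_iff P.isRegularLevel_bodyG _).2 q.2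

/-- **The boundary subtype of the body is the boundary level manifold**: the identity on
points is a diffeomorphism `∂Z ≅ {G = c}` (both inclusions into `ℝ⁴` are smooth embeddings).
[folklore] -/
def boundaryDiffeomorphBdry : ((𝓡∂ 4).boundary P.Body) ≃ₘ⟮𝓡 3, 𝓡 3⟯ P.Bdry where
  toFun z := ⟨z.1.1, P.apply_eq_of_boundary z⟩
  invFun q := ⟨P.toBody q, P.mem_boundary_of_level q⟩
  left_inv _ := rfl
  right_inv _ := rfl
  contMDiff_toFun := by
    have h1 : ContMDiff (𝓡 3) (𝓡 4) ∞ fun z : (𝓡∂ 4).boundary P.Body => (z.1.1 : 𝔼 4) :=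
      (RegularSublevel.contMDiff_incl P.isRegularLevel_bodyG).comp
        BoundaryManifold.isImmersion_subtype_val.contMDiff
    exact (ContMDiff.iff_comp_isImmersion (RegularLevel.isImmersion_incl P.isRegularLevel_bodyG)).2
      ⟨h1.continuous.subtype_mk _, h1⟩
  contMDiff_invFun := by
    have h1 : ContMDiff (𝓡 3) (𝓡 4) ∞ fun q : P.Bdry => (q.1 : 𝔼 4) :=
      RegularLevel.contMDiff_incl P.isRegularLevel_bodyG
    have h2 : ContMDiff (𝓡 3) (𝓡∂ 4) ∞ P.toBody :=
      (ContMDiff.iff_comp_isImmersion (RegularSublevel.isSmoothEmbedding_incl P.isRegularLevel_bodyG).isImmersion).2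
        ⟨h1.continuous.subtype_mk _, h1⟩
    exact (ContMDiff.iff_comp_isImmersion BoundaryManifold.isImmersion_subtype_val).2
      ⟨h2.continuous.subtype_mk _, h2⟩

/-! ### §2 Extending a diffeomorphism of `∂Z` diffeotopic to the identity over `Z` -/

/-- **A diffeomorphism of the boundary level manifold, diffeotopic to the identity, extends to
a diffeomorphism of the ladder body** (conjugate to the boundary subtype, where diffeotopic to
the identity is kept — `AmbientIsotopy.transfer` — and apply the collar fact
`BoundaryData.diffeoExtends_of_isDiffeotopicToId_holds`, Hirsch Ch. 8 §2, Thm. 2.3).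
[cite: HirschDT1976, Ch. 8 §2, proof of Thm. 2.3] -/
theorem exists_diffeomorph_body_extends {Φ : P.Bdry ≃ₘ⟮𝓡 3, 𝓡 3⟯ P.Bdry}
    (hΦ : Diffeomorph.IsDiffeotopicToId Φ) :
    ∃ Ψ : P.Body ≃ₘ⟮𝓡∂ 4, 𝓡∂ 4⟯ P.Body,
      ∀ q : P.Bdry, (Ψ (P.toBody q)).1 = (Φ q).1 := by
  set e := P.boundaryDiffeomorphBdry
  -- conjugate `Φ` to the boundary subtype
  set ψ : ((𝓡∂ 4).boundary P.Body) ≃ₘ⟮𝓡 3, 𝓡 3⟯ ((𝓡∂ 4).boundary P.Body) := e.trans (Φ.trans e.symm)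
  have hψ : Diffeomorph.IsDiffeotopicToId ψ := by
    rw [Diffeomorph.isDiffeotopicToId_iff_isAmbientIsotopic_of_finiteDimensional] at hΦ ⊢
    obtain ⟨F, hF⟩ := hΦ
    refine ⟨F.transfer e.symm, funext fun z => ?_⟩
    show e.symm (F.toFun 1 (e z)) = e.symm (Φ (e z))
    rw [show F.toFun 1 (e z) = Φ (e z) from by simpa using congrFun hF (e z)]
  obtain ⟨Ψ, hΨ⟩ := BoundaryData.diffeoExtends_of_isDiffeotopicToId_holds 3 P.Body P.bodyBoundaryData ψ hψ
  refine ⟨Ψ, fun q => ?_⟩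
  have := congrFun hΨ (e.symm q)
  simp only [Function.comp_apply] at this
  -- `b.incl = Subtype.val`
  have hincl : ∀ z, P.bodyBoundaryData.incl z = z.1 := fun z => rfl
  rw [hincl, hincl] at this
  have hz : (e.symm q).1 = P.toBody q := rfl
  rw [hz] at this
  rw [this]
  rfl

end Ladder.Params

end Literature.Topology.FourManifolds
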